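import Mathlib

/-!
# BirchSwinnertonDyer / VerticalContact — crux `VerticalContact` (stmt-BirchSwinnertonDyer-18431):
# the ultrametric DEPTH-SHIFT transfer (the `ℤ_[p]` core of line `first-layer-depth`'s transfer stub)

Support lemmas (helper file, `--supports stmt-BirchSwinnertonDyer-18431`) for the crux
`Summit.BirchSwinnertonDyer.BirchSwinnertonDyer.Theses.VerticalContact.VerticalContact` and its
quantifier-repaired form `Census.VerticalContactR` (`Cruxes/VerticalContact/CensusSketch.lean`).

The crux bounds, at every depth `N`, the `𝔓`-adic depth of a sampled Gross period `P_N` by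
`2m(N+1) + C` with `2m ≤ r_an(E) + r_an(E^{d_K})`.  In line `first-layer-depth`
(`Cruxes/VerticalContact/Ideas/first-layer-depth.md`) the periods are values
`P_N ≐ J(x_N)` of ONE integral Iwasawa germ `J(X) = ∑ bₙ Xⁿ ∈ ℤ_[p]⟦X⟧` at points `x_N` of
`p`-adic valuation `N + 1` (the weight parameters `(1+p)^{k_N-2} - 1`).  This file proves the
whole analytic ("transfer") step of that line over `ℤ_[p]`, with no number theory:

* `verticalContact_norm_tsum_mul_pow_le` — ultrametric Taylor bound `‖J(x)‖ ≤ ‖x‖^m` when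
  `b₀ = … = b_{m-1} = 0`;
* `verticalContact_exists_coeff_ne_zero_of_lt` — ONE value bounds the order: if
  `‖x‖^(m+1) < ‖J(x)‖` then some `bₙ ≠ 0` with `n ≤ m`;
* `verticalContact_norm_tsum_eq_leading` — leading-term domination: if `bₙ = 0` for `n < o` and
  `‖x‖ < ‖b_o‖` then `‖J(x)‖ = ‖b_o‖·‖x‖^o` (so `J(x) ≠ 0` and
  `v(J(x)) = v(b_o) + o·v(x)`, `verticalContact_valuation_tsum_eq_leading`);
* `verticalContact_depthShift` — the transfer in the shape the crux's `∀ N` clause consumes: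
  from ONE first-layer value (`x₀` of valuation `1` with `v(J(x₀)) ≤ m`) there are a shift `d`
  and a constant `C` such that for EVERY `N` the point `x_{N+d}` (valuation `N + d + 1`) has
  `J(x_{N+d}) ≠ 0` and `2·v(J(x_{N+d})) ≤ 2m(N+1) + C`.  Serving depth `N` by the admissible
  weight of depth `N + d` is legitimate in the crux because its `Form` clause is monotone in the
  depth (`2(p-1)p^{N+d} ∣ k-2 ⇒ 2(p-1)p^N ∣ k-2`, and a congruence modulo `𝔓^{e(N+d+1)}` is one
  modulo `𝔓^{e(N+1)}`); this replaces the Strassmann zero-dodging of the idea card by a shift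
  Mathlib can do today.

Design: valuations are `PadicInt.valuation : ℤ_[p] → ℕ`; orders of vanishing are carried as an
explicit index `o` with `∀ n < o, b n = 0 ∧ b o ≠ 0` (no `Nat.find`).  Deliberately NOT here: the
valuation `v((1+p)^M - 1) = 1 + v(M)` of the weight parameters (lifting the exponent; it belongs
to the supply stub), and anything quaternionic.
-/

set_option linter.dupNamespace false

namespace Summit.BirchSwinnertonDyer.BirchSwinnertonDyer.Theorems

open scoped BigOperators

variable {p : ℕ} [Fact p.Prime]

/-- An integral `p`-adic power series `∑ bₙ xⁿ` is summable at every point `x` of the open unit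
disc of `ℤ_[p]` (its terms are bounded by the geometric series `‖x‖ⁿ`). -/
theorem verticalContact_summable_mul_pow (b : ℕ → ℤ_[p]) {x : ℤ_[p]} (hx : ‖x‖ < 1) :
    Summable (fun n => b n * x ^ n) := by
  have hx0 : 0 ≤ ‖x‖ := norm_nonneg x
  refine Summable.of_norm_bounded (summable_geometric_of_lt_one hx0 hx) (fun n => ?_)
  rw [norm_mul, norm_pow]
  exact mul_le_of_le_one_left (pow_nonneg hx0 _) (PadicInt.norm_le_one _)

/-- **Ultrametric Taylor bound.** For an integral `p`-adic power series `∑ bₙ Xⁿ` whose first `m`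
coefficients vanish and any `x ∈ ℤ_[p]`: `‖∑ bₙ xⁿ‖ ≤ ‖x‖ ^ m` (no summability hypothesis is
needed: the junk value `0` of a non-summable `tsum` satisfies the bound). -/
theorem verticalContact_norm_tsum_mul_pow_le (b : ℕ → ℤ_[p]) (x : ℤ_[p]) (m : ℕ)
    (hb : ∀ n < m, b n = 0) : ‖∑' n, b n * x ^ n‖ ≤ ‖x‖ ^ m := by
  refine IsUltrametricDist.norm_tsum_le_of_forall_le_of_nonneg (by positivity) fun n => ?_
  by_cases hn : n < m
  · simp [hb n hn]
  · rw [not_lt] at hn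
    calc ‖b n * x ^ n‖ ≤ ‖b n‖ * ‖x ^ n‖ := norm_mul_le _ _
      _ ≤ 1 * ‖x‖ ^ n := by
          gcongr
          · exact PadicInt.norm_le_one _
          · exact norm_pow_le x n
      _ ≤ ‖x‖ ^ m := by
          rw [one_mul]
          exact pow_le_pow_of_le_one (norm_nonneg _) (PadicInt.norm_le_one _) hn

/-- **One value bounds the order of vanishing** (contrapositive of the Taylor bound): if the
value at `x` is larger than `‖x‖^(m+1)` then one of `b₀, …, b_m` is non-zero, i.e.
`ord_{X=0} (∑ bₙ Xⁿ) ≤ m`. -/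
theorem verticalContact_exists_coeff_ne_zero_of_lt (b : ℕ → ℤ_[p]) (x : ℤ_[p]) (m : ℕ)
    (h : ‖x‖ ^ (m + 1) < ‖∑' n, b n * x ^ n‖) : ∃ n ≤ m, b n ≠ 0 := by
  by_contra hcon
  simp only [not_exists, not_and, not_not] at hcon
  exact absurd h (not_lt.mpr
    (verticalContact_norm_tsum_mul_pow_le b x (m + 1) (fun n hn => hcon n (by omega))))

/-- **The order as data.** If some `bₙ ≠ 0` with `n ≤ m`, there is a least such index `o ≤ m`:
`b_o ≠ 0` and `bₙ = 0` for all `n < o`. -/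
theorem verticalContact_exists_order_le (b : ℕ → ℤ_[p]) (m : ℕ) (h : ∃ n ≤ m, b n ≠ 0) :
    ∃ o ≤ m, b o ≠ 0 ∧ ∀ n < o, b n = 0 := by
  classical
  obtain ⟨n, hnm, hn⟩ := h
  have hex : ∃ k, b k ≠ 0 := ⟨n, hn⟩
  refine ⟨Nat.find hex, (Nat.find_min' hex hn).trans hnm, Nat.find_spec hex, fun k hk => ?_⟩
  by_contra hk'
  exact Nat.find_min hex hk hk'

/-- **Leading-term domination** (ultrametric): if `bₙ = 0` for `n < o` and `‖x‖ < ‖b_o‖`, the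
term `b_o x^o` strictly dominates the tail, so `‖∑ bₙ xⁿ‖ = ‖b_o‖ · ‖x‖ ^ o`. -/
theorem verticalContact_norm_tsum_eq_leading (b : ℕ → ℤ_[p]) (o : ℕ) (hb : ∀ n < o, b n = 0)
    (x : ℤ_[p]) (hx : ‖x‖ < ‖b o‖) : ‖∑' n, b n * x ^ n‖ = ‖b o‖ * ‖x‖ ^ o := by
  have hbo1 : ‖b o‖ ≤ 1 := PadicInt.norm_le_one _
  have hx1 : ‖x‖ < 1 := lt_of_lt_of_le hx hbo1
  have hx0 : 0 ≤ ‖x‖ := norm_nonneg x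
  by_cases hxz : x = 0
  · subst hxz
    have h0 : ∑' n, b n * (0 : ℤ_[p]) ^ n = b 0 := by
      rw [tsum_eq_single 0 (fun n hn => by simp [zero_pow hn])]
      simp
    rw [h0]
    cases o with
    | zero => simp
    | succ o => simp [hb 0 (by omega)]
  · have hxpos : 0 < ‖x‖ := norm_pos_iff.mpr hxz
    have hsumm := verticalContact_summable_mul_pow b hx1
    have hhead : ∑ i ∈ Finset.range (o + 1), b i * x ^ i = b o * x ^ o := by
      rw [Finset.sum_range_succ, Finset.sum_eq_zero (fun i hi => ?_), zero_add]
      rw [hb i (Finset.mem_range.mp hi), zero_mul]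
    have htail : ‖∑' i, b (i + (o + 1)) * x ^ (i + (o + 1))‖ ≤ ‖x‖ ^ (o + 1) := by
      refine IsUltrametricDist.norm_tsum_le_of_forall_le_of_nonneg (pow_nonneg hx0 _) fun i => ?_
      calc ‖b (i + (o + 1)) * x ^ (i + (o + 1))‖ ≤ ‖x‖ ^ (i + (o + 1)) := by
            rw [norm_mul, norm_pow]
            exact mul_le_of_le_one_left (pow_nonneg hx0 _) (PadicInt.norm_le_one _)
        _ ≤ ‖x‖ ^ (o + 1) := pow_le_pow_of_le_one hx0 hx1.le (by omega)
    have hmain : ‖b o * x ^ o‖ = ‖b o‖ * ‖x‖ ^ o := by rw [norm_mul, norm_pow]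
    have hlt : ‖∑' i, b (i + (o + 1)) * x ^ (i + (o + 1))‖ < ‖b o * x ^ o‖ := by
      rw [hmain]
      calc ‖∑' i, b (i + (o + 1)) * x ^ (i + (o + 1))‖ ≤ ‖x‖ ^ (o + 1) := htail
        _ = ‖x‖ ^ o * ‖x‖ := pow_succ _ _
        _ < ‖x‖ ^ o * ‖b o‖ := mul_lt_mul_of_pos_left hx (pow_pos hxpos _)
        _ = ‖b o‖ * ‖x‖ ^ o := mul_comm _ _
    rw [← hsumm.sum_add_tsum_nat_add (o + 1), hhead,
      IsUltrametricDist.norm_add_eq_max_of_norm_ne_norm (ne_of_gt hlt), max_eq_left hlt.le, hmain]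

/-- Two non-zero `p`-adic integers with the same norm have the same valuation. -/
theorem verticalContact_valuation_eq_of_norm_eq {x y : ℤ_[p]} (hx : x ≠ 0) (hy : y ≠ 0)
    (h : ‖x‖ = ‖y‖) : x.valuation = y.valuation := by
  rw [PadicInt.norm_eq_zpow_neg_valuation hx, PadicInt.norm_eq_zpow_neg_valuation hy] at h
  have hp1 : (1 : ℝ) < p := by exact_mod_cast (Fact.out : p.Prime).one_lt
  have hinj := zpow_right_injective₀ (zero_lt_one.trans hp1) hp1.ne' h
  simp only [neg_inj, Nat.cast_inj] at hinj
  exact hinj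

/-- **Leading-term domination, valuation form.** If `bₙ = 0` for `n < o`, `b_o ≠ 0` and
`v(b_o) < v(x)` for a non-zero `x ∈ ℤ_[p]`, then `J(x) = ∑ bₙ xⁿ ≠ 0` and
`v(J(x)) = v(b_o) + o · v(x)`. -/
theorem verticalContact_valuation_tsum_eq_leading (b : ℕ → ℤ_[p]) (o : ℕ)
    (hb : ∀ n < o, b n = 0) (hbo : b o ≠ 0) (x : ℤ_[p]) (hx : x ≠ 0)
    (hv : (b o).valuation < x.valuation) :
    (∑' n, b n * x ^ n) ≠ 0 ∧
      (∑' n, b n * x ^ n).valuation = (b o).valuation + o * x.valuation := by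
  have hp1 : (1 : ℝ) < p := by exact_mod_cast (Fact.out : p.Prime).one_lt
  have hnorm : ‖x‖ < ‖b o‖ := by
    rw [PadicInt.norm_eq_zpow_neg_valuation hx, PadicInt.norm_eq_zpow_neg_valuation hbo]
    exact zpow_lt_zpow_right₀ hp1 (by omega)
  have heq := verticalContact_norm_tsum_eq_leading b o hb x hnorm
  have hhead : ‖b o * x ^ o‖ = ‖b o‖ * ‖x‖ ^ o := by rw [norm_mul, norm_pow]
  have hheadne : b o * x ^ o ≠ 0 := mul_ne_zero hbo (pow_ne_zero _ hx)
  have hne : (∑' n, b n * x ^ n) ≠ 0 := by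
    intro h0
    rw [h0, norm_zero, ← hhead] at heq
    exact hheadne (norm_eq_zero.mp heq.symm)
  refine ⟨hne, ?_⟩
  rw [← hhead] at heq
  rw [verticalContact_valuation_eq_of_norm_eq hne hheadne heq,
    PadicInt.valuation_mul hbo (pow_ne_zero _ hx), PadicInt.valuation_pow]

/-- **One first-layer value bounds the order** (valuation form): if `x₀ ≠ 0`, `J(x₀) ≠ 0` and
`v(J(x₀)) < (m+1) · v(x₀)`, then `J` has a non-zero coefficient of index `≤ m`; in particular for
`v(x₀) = 1` the hypothesis is `v(J(x₀)) ≤ m`. -/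
theorem verticalContact_exists_coeff_ne_zero_of_valuation_lt (b : ℕ → ℤ_[p]) (x₀ : ℤ_[p])
    (m : ℕ) (hx₀ : x₀ ≠ 0) (hJ : (∑' n, b n * x₀ ^ n) ≠ 0)
    (hv : (∑' n, b n * x₀ ^ n).valuation < (m + 1) * x₀.valuation) : ∃ n ≤ m, b n ≠ 0 := by
  have hp1 : (1 : ℝ) < p := by exact_mod_cast (Fact.out : p.Prime).one_lt
  refine verticalContact_exists_coeff_ne_zero_of_lt b x₀ m ?_
  rw [PadicInt.norm_eq_zpow_neg_valuation hx₀, PadicInt.norm_eq_zpow_neg_valuation hJ,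
    ← zpow_natCast, ← zpow_mul]
  refine zpow_lt_zpow_right₀ hp1 ?_
  have : ((∑' n, b n * x₀ ^ n).valuation : ℤ) < ((m + 1 : ℕ) : ℤ) * (x₀.valuation : ℤ) := by
    exact_mod_cast hv
  push_cast at this ⊢
  linarith

/-- **Depth-shift transfer** (the analytic half of line `first-layer-depth`, in the shape the
crux's `∀ N` clause consumes).  Let `J(x) = ∑ bₙ xⁿ` be an integral `p`-adic germ sampled at
points `xw N ∈ ℤ_[p]` of valuation exactly `N + 1` (the weight parameters of the admissible
weights of depth `N`).  If the FIRST-LAYER value is not too deep — `J(xw 0) ≠ 0` and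
`v(J(xw 0)) ≤ m` — then there are a shift `d` and a constant `C` such that at EVERY depth `N` the
deeper sample `xw (N + d)` has `J ≠ 0` and `2 · v(J(xw (N + d))) ≤ 2 m (N + 1) + C`: contact order
at most `m`, read off one value.  (`d = v(b_o)` and `C = 2 (m+1) v(b_o)` for the order `o ≤ m` and
leading coefficient `b_o` of `J`.) -/
theorem verticalContact_depthShift (b : ℕ → ℤ_[p]) (m : ℕ) (xw : ℕ → ℤ_[p])
    (hxw : ∀ N, xw N ≠ 0 ∧ (xw N).valuation = N + 1)
    (h0 : (∑' n, b n * xw 0 ^ n) ≠ 0) (hm : (∑' n, b n * xw 0 ^ n).valuation ≤ m) :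
    ∃ d C : ℕ, ∀ N : ℕ, (∑' n, b n * xw (N + d) ^ n) ≠ 0 ∧
      2 * (∑' n, b n * xw (N + d) ^ n).valuation ≤ 2 * m * (N + 1) + C := by
  -- the order `o ≤ m` of `J`, from the one first-layer value
  have hcoeff : ∃ n ≤ m, b n ≠ 0 := by
    refine verticalContact_exists_coeff_ne_zero_of_valuation_lt b (xw 0) m (hxw 0).1 h0 ?_
    rw [(hxw 0).2]
    omega
  obtain ⟨o, hom, hbo, hb⟩ := verticalContact_exists_order_le b m hcoeff
  -- shift past the valuation of the leading coefficient; then the leading term dominates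
  refine ⟨(b o).valuation, 2 * (m + 1) * (b o).valuation, fun N => ?_⟩
  have hxN := hxw (N + (b o).valuation)
  have hv : (b o).valuation < (xw (N + (b o).valuation)).valuation := by
    rw [hxN.2]
    omega
  obtain ⟨hne, hval⟩ :=
    verticalContact_valuation_tsum_eq_leading b o hb hbo (xw (N + (b o).valuation)) hxN.1 hv
  refine ⟨hne, ?_⟩
  rw [hval, hxN.2]
  have h1 : o * (N + (b o).valuation + 1) ≤ m * (N + (b o).valuation + 1) :=
    Nat.mul_le_mul_right _ hom
  nlinarith [h1, Nat.zero_le ((b o).valuation), Nat.zero_le m]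

/-- **Weight parameters (lifting the exponent).** For an odd prime `p` and `M ≠ 0` the element
`(1+p)^M - 1 ∈ ℤ_[p]` is non-zero of valuation `1 + v_p(M)`. -/
theorem verticalContact_weightParam_valuation (hp2 : p ≠ 2) {M : ℕ} (hM : M ≠ 0) :
    ((1 + p : ℤ_[p]) ^ M - 1) ≠ 0 ∧
      ((1 + p : ℤ_[p]) ^ M - 1).valuation = 1 + padicValNat p M := by
  have hprime : p.Prime := Fact.out
  have hodd : Odd p := hprime.odd_of_ne_two hp2
  have hp1 : 1 < p := hprime.one_lt
  have h1 : 1 ≤ (1 + p) ^ M := Nat.one_le_pow _ _ (by omega)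
  have hcast : (((1 + p) ^ M - 1 : ℕ) : ℤ_[p]) = (1 + p : ℤ_[p]) ^ M - 1 := by
    push_cast [Nat.cast_sub h1]
    ring
  have hx : ¬ p ∣ 1 + p := by
    rw [Nat.dvd_add_self_right]
    exact hprime.not_dvd_one
  have hval : padicValNat p ((1 + p) ^ M - 1 ^ M) = padicValNat p (1 + p - 1) + padicValNat p M :=
    padicValNat.pow_sub_pow hodd (by omega) (by simp) hx hM
  rw [one_pow, Nat.add_sub_cancel_left, padicValNat_self] at hval
  have hpos : (1 + p) ^ M - 1 ≠ 0 := by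
    have : 1 + p ≤ (1 + p) ^ M := by
      calc 1 + p = (1 + p) ^ 1 := (pow_one _).symm
        _ ≤ (1 + p) ^ M := Nat.pow_le_pow_right (by omega) (Nat.one_le_iff_ne_zero.mpr hM)
    omega
  refine ⟨?_, ?_⟩
  · rw [← hcast]
    exact_mod_cast hpos
  · -- `(n : ℤ_[p]).valuation = padicValNat p n` (cf. the landed
    -- `Literature.NumberTheory.EllipticCurves.ModularForms.LieGame.valuation_natCast_eq`,
    -- re-derived inline to keep this file's import cone at `Mathlib`)
    have hnat : ∀ n : ℕ, (n : ℤ_[p]).valuation = padicValNat p n := fun n => by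
      have h := PadicInt.valuation_coe (n : ℤ_[p])
      rw [PadicInt.coe_natCast, Padic.valuation_natCast] at h
      exact_mod_cast h.symm
    rw [← hcast, hnat, hval]

/-- **Depth of the admissible weights.** For an odd prime `p`, `c` prime to `p` and any `N`, the
weight parameter `(1+p)^(c·p^N) - 1` of the weight `k = 2 + c·p^N` (in the crux
`c = 2(p-1)·h_K·t`, `p ∤ 6 h_K`, `p ∤ t`) is non-zero of valuation exactly `N + 1`. -/
theorem verticalContact_weightParam_depth (hp2 : p ≠ 2) {c : ℕ} (hc : ¬ p ∣ c) (N : ℕ) :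
    ((1 + p : ℤ_[p]) ^ (c * p ^ N) - 1) ≠ 0 ∧
      ((1 + p : ℤ_[p]) ^ (c * p ^ N) - 1).valuation = N + 1 := by
  have hprime : p.Prime := Fact.out
  have hc0 : c ≠ 0 := by rintro rfl; exact hc (dvd_zero p)
  have hM : c * p ^ N ≠ 0 := mul_ne_zero hc0 (pow_ne_zero _ hprime.ne_zero)
  obtain ⟨hne, hval⟩ := verticalContact_weightParam_valuation (p := p) hp2 hM
  refine ⟨hne, ?_⟩
  rw [hval, padicValNat.mul hc0 (pow_ne_zero _ hprime.ne_zero), padicValNat.prime_pow,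
    padicValNat.eq_zero_of_not_dvd hc]
  ring

/-- **Depth-shift transfer along the admissible weights** (`verticalContact_depthShift` at the
weight parameters `x_N = (1+p)^(c·p^N) - 1`): for an odd prime `p`, `p ∤ c`, an integral germ
`J = ∑ bₙ Xⁿ` and a target order `m`, ONE first-layer value with `J(x₀) ≠ 0`, `v(J(x₀)) ≤ m`
yields `d, C` with `J(x_{N+d}) ≠ 0` and `2·v(J(x_{N+d})) ≤ 2m(N+1) + C` for every depth `N`. -/
theorem verticalContact_depthShift_weights (hp2 : p ≠ 2) {c : ℕ} (hc : ¬ p ∣ c)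
    (b : ℕ → ℤ_[p]) (m : ℕ)
    (h0 : (∑' n, b n * ((1 + p : ℤ_[p]) ^ (c * p ^ 0) - 1) ^ n) ≠ 0)
    (hm : (∑' n, b n * ((1 + p : ℤ_[p]) ^ (c * p ^ 0) - 1) ^ n).valuation ≤ m) :
    ∃ d C : ℕ, ∀ N : ℕ, (∑' n, b n * ((1 + p : ℤ_[p]) ^ (c * p ^ (N + d)) - 1) ^ n) ≠ 0 ∧
      2 * (∑' n, b n * ((1 + p : ℤ_[p]) ^ (c * p ^ (N + d)) - 1) ^ n).valuation
        ≤ 2 * m * (N + 1) + C :=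
  verticalContact_depthShift b m (fun N => (1 + p : ℤ_[p]) ^ (c * p ^ N) - 1)
    (fun N => verticalContact_weightParam_depth hp2 hc N) h0 hm

end Summit.BirchSwinnertonDyer.BirchSwinnertonDyer.Theorems
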